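import Summits.RiemannHypothesis.RiemannHypothesis.Theorems.WeilParityEvenWinsBeyondArchFrontierCell8OfBlocks
import HarnessLib

/-!
# RiemannHypothesis / GroundBarta — the parity ladder: the GENERIC LADDER STEP (one cell from a U-side and an odd L-side)

Helper file (`--supports stmt-RiemannHypothesis-18085`, NoParityCrossing), RH-free, pure logic.  Prover A (g21 of unit
`sr-gb-rung-a`), after prover A g11's `…FrontierCell7OfBlocks` and prover B g8's `…FrontierCell8OfBlocks` (the same step with the
numbers of cells 7 / 8 written in).  With the lead's ruling R17-4⁗ (2) the L-sides of the cells beyond `83/100` come from the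
format-C odd-sector λ-door (`WeilFormatC.le_weilOddGroundEnergy_of_formatC_oddKernelsA / …oddPiecesA`,
`2·λ' ≤ weilOddGroundEnergy c`) and the U-sides from the Rayleigh–Ritz files (`…Upper83Sharp`, `…Upper865Sharp`, …); this file is
the one lemma every further cell instantiates:

* `weilWindowSimpleEven_upTo_step`: ladder up to `b` (`WeilWindowSimpleEven a` for `0 < a ≤ b`) + U-side `ε(b) ≤ U` + L-side
  `U < L ≤ ε_od(c)` ⟹ ladder up to `c`;
* `weilEvenGroundEnergy_lt_weilOddGroundEnergy_upTo_step`, `tailSimpleEven_upTo_step`: the strict parity order / the item-18085 tail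
  shape up to `c`;
* `weilWindowSimpleEven_upTo_cell9_of` — cell 9 `[173/200, c₃]` spelled out: the ladder up to `173/200` (cells 7, 8) + a U-side
  `ε(173/200) ≤ U₉` (e.g. `trialUpper865sharp`, `U₉ = 705/10^23`) + `U₉ < L₉ ≤ ε_od(c₃)`.

Mechanism (`GroundStateSimpleEven.weilWindowSimpleEven_on_cell_of_le`, landed): on `[b, c]`, `ε(a) ≤ ε(b) ≤ U < L ≤ ε_od(c) ≤ ε_od(a)`
(`ε`, `ε_od` antitone), so the even sector carries the bottom strictly.  Nothing here bears on the truth of RH.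
-/

set_option linter.dupNamespace false

noncomputable section

open Set MeasureTheory

namespace Summit.RiemannHypothesis.RiemannHypothesis.Theorems.EvenWinsBeyondArch

open Literature.NumberTheory.LFunctions

/-- **The ladder step.** Ladder up to `b` + U-side at `b` + odd L-side at `c` above it ⟹ ladder up to `c`. [folklore] -/
theorem weilWindowSimpleEven_upTo_step {b c U L : ℝ} (hb : 0 < b)
    (hprev : ∀ a : ℝ, 0 < a → a ≤ b → WeilWindowSimpleEven a)
    (hU : weilGroundEnergy b ≤ U) (hUL : U < L) (hL : L ≤ weilOddGroundEnergy c) :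
    ∀ a : ℝ, 0 < a → a ≤ c → WeilWindowSimpleEven a := by
  intro a ha hac
  rcases le_or_gt a b with hab | hba
  · exact hprev a ha hab
  · exact GroundStateSimpleEven.weilWindowSimpleEven_on_cell_of_le hb hUL hU
      (fun _ hg hs hn ho ↦ hL.trans (weilOddGroundEnergy_le hg hs ho hn)) hba.le hac

/-- The strict parity order `ε_ev(a) < ε_od(a)` for every `0 < a ≤ c`, from a ladder step. [folklore] -/
theorem weilEvenGroundEnergy_lt_weilOddGroundEnergy_upTo_step {b c U L : ℝ} (hb : 0 < b)
    (hprev : ∀ a : ℝ, 0 < a → a ≤ b → WeilWindowSimpleEven a)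
    (hU : weilGroundEnergy b ≤ U) (hUL : U < L) (hL : L ≤ weilOddGroundEnergy c) {a : ℝ} (ha : 0 < a) (hac : a ≤ c) :
    weilEvenGroundEnergy a < weilOddGroundEnergy a :=
  (weilWindowSimpleEven_iff_weilEvenGroundEnergy_lt ha).1 (weilWindowSimpleEven_upTo_step hb hprev hU hUL hL a ha hac)

/-- Tail shape of item 18085 (windows beyond `log 2`) up to `c`, from a ladder step. [folklore] -/
theorem tailSimpleEven_upTo_step {b c U L : ℝ} (hb : 0 < b)
    (hprev : ∀ a : ℝ, 0 < a → a ≤ b → WeilWindowSimpleEven a)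
    (hU : weilGroundEnergy b ≤ U) (hUL : U < L) (hL : L ≤ weilOddGroundEnergy c) :
    ∀ a : ℝ, Real.log 2 < a → a ≤ c → WeilWindowSimpleEven a :=
  fun a ha hac ↦ weilWindowSimpleEven_upTo_step hb hprev hU hUL hL a ((Real.log_pos (by norm_num)).trans ha) hac

/-- **Cell 9 `[173/200, c₃]` spelled out.** From cell 7's odd bound at `83/100` (`10⁻¹⁷ < L₇ ≤ ε_od(83/100)`), cell 8's odd bound at
`173/200` (`483·10⁻²¹ < L₈ ≤ ε_od(173/200)`), a U-side at `173/200` (`ε(173/200) ≤ U₉`, e.g. `trialUpper865sharp` with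
`U₉ = 705/10^23`) and cell 9's odd bound `U₉ < L₉ ≤ ε_od(c₃)`: the ladder reaches `c₃`. [folklore] -/
theorem weilWindowSimpleEven_upTo_cell9_of {c₃ L₇ L₈ U₉ L₉ : ℝ}
    (hUL₇ : (1 / 100000000000000000 : ℝ) < L₇) (hL₇ : L₇ ≤ weilOddGroundEnergy (83 / 100))
    (hUL₈ : (483 / 1000000000000000000000 : ℝ) < L₈) (hL₈ : L₈ ≤ weilOddGroundEnergy (173 / 200))
    (hU₉ : weilGroundEnergy (173 / 200) ≤ U₉) (hUL₉ : U₉ < L₉) (hL₉ : L₉ ≤ weilOddGroundEnergy c₃) :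
    ∀ a : ℝ, 0 < a → a ≤ c₃ → WeilWindowSimpleEven a :=
  weilWindowSimpleEven_upTo_step (b := 173 / 200) (by norm_num)
    (weilWindowSimpleEven_upTo_cell8_of_oddLowers hUL₇ hL₇ hUL₈ hL₈) hU₉ hUL₉ hL₉

end Summit.RiemannHypothesis.RiemannHypothesis.Theorems.EvenWinsBeyondArch

end
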